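import Summits.KontsevichZagierPeriods.KontsevichZagierPeriods.Theses.GaussManinCertificates
import Literature.NumberTheory.Transcendental.KZLogCalculusProofs
import Literature.NumberTheory.Transcendental.KZDominatedFamilyRelations
import Literature.NumberTheory.Transcendental.KZCalculusProofs
import Literature.NumberTheory.Transcendental.SemialgebraicAlgebraicPoints
import Literature.NumberTheory.Transcendental.KZSemialgebraicComplex
import Summits.KontsevichZagierPeriods.KontsevichZagierPeriods.Theorems.HermiteRigidityCMTwistQuasiPeriodTransferMoves

/-!
# `KZStokesBox` (stmt-KontsevichZagierPeriods-3015): Newton–Leibniz on an open box with real corners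

Route `GaussManinCertificates`, support item `KZStokesBox`: for an integral representation `r` in
dimension `n + 1` whose domain is the OPEN box `∏ᵢ (aᵢ, bᵢ)` (real corners `a < b`), and a function
`H`, `ℚ`-semialgebraic on the closed box, which on every vertical fibre over the open base box is
continuous on `[a_last, b_last]`, vanishes at both ends and has derivative `r.integrand` on
`(a_last, b_last)`, the class `[r]` lies in `KZ.relations`.

Proof (one band over the base box, as planned in the route file):

* the corners `aᵢ, bᵢ` are algebraic over `ℚ`: the open box is `ℚ`-semialgebraic (it is
  `r.domain`), its coordinate projections are the intervals `(aᵢ, bᵢ) ⊆ ℝ¹` (Tarski–Seidenberg,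
  `IsSemialgebraic.image_comp`), and boundary points of `ℚ`-semialgebraic subsets of the line are
  algebraic (`isAlgebraic_of_mem_frontier`); hence the open base box `τ`, the constant edge
  functions `a_last`, `b_last` on `τ` and the band `B = τ × [a_last, b_last]` are `ℚ`-semialgebraic
  (`isSemialgebraicFunOn_const_of_isAlgebraic`, `KZlog.isSemialgebraic_band`; the half-spaces with an
  algebraic bound are those of `Theorems/HermiteRigidityCMTwistQuasiPeriodTransferMoves.lean`);
* the band representation `R = [B, g]`, `g = r.integrand` extended by `0` off the open box
  (semialgebraic by gluing, `IsSemialgebraicFunOn.union`; integrable since `B ∖ box` is null), and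
  the zero representation `Z = [τ, 0]` form ONE instance of the Newton–Leibniz move
  (`KZ.newtonLeibnizRel`, primitive `H`, boundary values `H(x, b_last) − H(x, a_last) = 0 − 0`);
* `[Z] ∈ relations` (zero integrand), `[R] − [R|box] ∈ relations` (the two faces
  `{z_last = a_last}`, `{z_last = b_last}` are null: domain additivity,
  `KZ.IntegralRep.of_sub_of_restrict_mem_relations`), and `[R|box] − [r] ∈ relations` (same domain,
  integrands agree on it, `KZ.of_sub_of_mem_relations_of_eqOn`).

No named fact is assumed; no new definition. The closing theorem is `KZStokesBox_proof`.
-/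

noncomputable section

open MeasureTheory Set Filter Topology
open Literature.ModelTheory.ExponentialFields (IsSemialgebraic isSemialgebraic_univ)
open Literature.NumberTheory.Transcendental
open Summit.KontsevichZagierPeriods.HermiteRigidity.CMTwistQuasiPeriodTransfer
  (isSemialgebraic_setOf_apply_lt_of_isAlgebraic isSemialgebraic_setOf_apply_gt_of_isAlgebraic)

namespace Summit.KontsevichZagierPeriods.GaussManinCertificates

/-! ### Corners of a `ℚ`-semialgebraic open box are algebraic -/

/-- The coordinate projections of the open box `∏ᵢ (aᵢ, bᵢ)` (`a < b`) are the intervals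
`(aᵢ, bᵢ) ⊆ ℝ¹`. [folklore] -/
theorem image_comp_const_openBox {N : ℕ} {a b : Fin N → ℝ} (hab : ∀ i, a i < b i) (i : Fin N) :
    ((fun w : Fin N → ℝ => w ∘ fun _ : Fin 1 => i) '' {z : Fin N → ℝ | ∀ j, z j ∈ Ioo (a j) (b j)}) =
      {t : Fin 1 → ℝ | t 0 ∈ Ioo (a i) (b i)} := by
  ext t
  simp only [mem_image, mem_setOf_eq]
  constructor
  · rintro ⟨w, hw, rfl⟩
    exact hw i
  · intro ht
    refine ⟨Function.update (fun j => (a j + b j) / 2) i (t 0), fun j => ?_, ?_⟩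
    · by_cases hj : j = i
      · subst hj
        simpa using ht
      · rw [Function.update_of_ne hj]
        have := hab j
        constructor <;> linarith
    · funext k
      rw [Subsingleton.elim k 0]
      simp

/-- The frontier of the interval `(c, d) ⊆ ℝ¹` (`c < d`), in the coordinates `Fin 1 → ℝ`, consists
of the two endpoints. [folklore] -/
theorem frontier_setOf_apply_mem_Ioo {c d : ℝ} (hcd : c < d) :
    frontier {t : Fin 1 → ℝ | t 0 ∈ Ioo c d} = {t | t 0 = c ∨ t 0 = d} := by
  have h1 : {t : Fin 1 → ℝ | t 0 ∈ Ioo c d} = (Homeomorph.funUnique (Fin 1) ℝ) ⁻¹' Ioo c d := by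
    ext t
    simp
  rw [h1, ← Homeomorph.preimage_frontier, frontier_Ioo hcd]
  ext t
  simp

/-- **Corners of a `ℚ`-semialgebraic open box are algebraic.** If the open box `∏ᵢ (aᵢ, bᵢ)`
(`a < b`) is `ℚ`-semialgebraic then every `aᵢ` and every `bᵢ` is algebraic over `ℚ`: the
coordinate projection of the box is the `ℚ`-semialgebraic interval `(aᵢ, bᵢ) ⊆ ℝ¹`
(Tarski–Seidenberg), whose boundary points are algebraic (`isAlgebraic_of_mem_frontier`).
[folklore] -/
theorem isAlgebraic_corner_of_isSemialgebraic_openBox {N : ℕ} {a b : Fin N → ℝ}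
    (hab : ∀ i, a i < b i) (hS : IsSemialgebraic ℚ {z : Fin N → ℝ | ∀ j, z j ∈ Ioo (a j) (b j)})
    (i : Fin N) : IsAlgebraic ℚ (a i) ∧ IsAlgebraic ℚ (b i) := by
  have himg := hS.image_comp (fun _ : Fin 1 => i)
  rw [image_comp_const_openBox hab i] at himg
  have hfr := frontier_setOf_apply_mem_Ioo (hab i)
  constructor
  · refine isAlgebraic_of_mem_frontier (x := fun _ : Fin 1 => a i) himg ?_
    rw [hfr]
    simp
  · refine isAlgebraic_of_mem_frontier (x := fun _ : Fin 1 => b i) himg ?_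
    rw [hfr]
    simp

/-! ### Boxes with algebraic corners are `ℚ`-semialgebraic -/

/-- An open box `∏ᵢ (aᵢ, bᵢ) ⊆ ℝᴺ` with algebraic corners is `ℚ`-semialgebraic. [folklore] -/
theorem isSemialgebraic_openBox_of_isAlgebraic {N : ℕ} {a b : Fin N → ℝ}
    (ha : ∀ i, IsAlgebraic ℚ (a i)) (hb : ∀ i, IsAlgebraic ℚ (b i)) :
    IsSemialgebraic ℚ {z : Fin N → ℝ | ∀ i, z i ∈ Ioo (a i) (b i)} := by
  have h := IsSemialgebraic.biInter (Finset.univ : Finset (Fin N))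
    (fun i => {z : Fin N → ℝ | a i < z i} ∩ {z : Fin N → ℝ | z i < b i}) fun i _ =>
      (isSemialgebraic_setOf_apply_gt_of_isAlgebraic (ha i) i).inter
        (isSemialgebraic_setOf_apply_lt_of_isAlgebraic (hb i) i)
  convert h using 1
  ext z
  simp [mem_Ioo]

/-! ### The theorem -/

/-- Fibrewise membership in the open box: `(x, t) ∈ ∏ᵢ (aᵢ, bᵢ)` iff `x` lies in the open base box
and `t ∈ (a_last, b_last)`. [folklore] -/
theorem snoc_mem_openBox_iff {n : ℕ} {a b : Fin (n + 1) → ℝ} {x : Fin n → ℝ} {t : ℝ} :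
    (∀ i, (Fin.snoc x t : Fin (n + 1) → ℝ) i ∈ Ioo (a i) (b i)) ↔
      (∀ i : Fin n, x i ∈ Ioo (a (Fin.castSucc i)) (b (Fin.castSucc i))) ∧
        t ∈ Ioo (a (Fin.last n)) (b (Fin.last n)) := by
  constructor
  · intro h
    refine ⟨fun i => ?_, ?_⟩
    · simpa using h (Fin.castSucc i)
    · simpa using h (Fin.last n)
  · rintro ⟨hx, ht⟩ i
    refine Fin.lastCases ?_ (fun j => ?_) i
    · simpa using ht
    · simpa using hx j

/-- **`KZStokesBox`** (route `GaussManinCertificates`, item stmt-KontsevichZagierPeriods-3015):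
Newton–Leibniz on an open box with real corners. For `r : KZ.IntegralRep (n + 1)` with domain the
open box `∏ᵢ (aᵢ, bᵢ)` and `H` `ℚ`-semialgebraic on the closed box, fibrewise continuous on
`[a_last, b_last]`, vanishing at both ends and with fibrewise derivative `r.integrand` on
`(a_last, b_last)`, `KZ.of r ∈ KZ.relations`: one Newton–Leibniz move on the band
`τ × [a_last, b_last]` over the open base box `τ` (with the integrand extended by zero to the two
faces), the base `[τ, 0]` being a relation, the two faces being null (domain additivity), and the
restriction to the open box having the integrand of `r` (integrand additivity). The corners are
algebraic because the box is `ℚ`-semialgebraic (`isAlgebraic_corner_of_isSemialgebraic_openBox`).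
[Kontsevich–Zagier 2001, §1.2, rules 1) and 3)] -/
theorem KZStokesBox_proof :
    Summit.KontsevichZagierPeriods.KontsevichZagierPeriods.Theses.GaussManinCertificates.KZStokesBox := by
  intro n a b r H hab hdom hH hfib
  -- the corners are algebraic, so every box built from them is `ℚ`-semialgebraic
  have halg : ∀ i, IsAlgebraic ℚ (a i) ∧ IsAlgebraic ℚ (b i) :=
    isAlgebraic_corner_of_isSemialgebraic_openBox hab (hdom ▸ r.isSemialgebraic_domain)
  -- the open base box `τ` and the band `B = τ × [a_last, b_last]`
  set τ : Set (Fin n → ℝ) := {x | ∀ i, x i ∈ Ioo (a (Fin.castSucc i)) (b (Fin.castSucc i))}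
    with hτ_def
  have hτ : IsSemialgebraic ℚ τ :=
    isSemialgebraic_openBox_of_isAlgebraic (fun i => (halg _).1) fun i => (halg _).2
  have haS : IsSemialgebraicFunOn ℚ τ (fun _ => a (Fin.last n)) :=
    isSemialgebraicFunOn_const_of_isAlgebraic hτ (halg _).1
  have hbS : IsSemialgebraicFunOn ℚ τ (fun _ => b (Fin.last n)) :=
    isSemialgebraicFunOn_const_of_isAlgebraic hτ (halg _).2
  set B : Set (Fin (n + 1) → ℝ) := KZlog.band τ (fun _ => a (Fin.last n)) (fun _ => b (Fin.last n))
    with hB_def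
  have hB : IsSemialgebraic ℚ B := KZlog.isSemialgebraic_band haS hbS
  -- `box ⊆ B ⊆ closed box`
  have hOB : r.domain ⊆ B := by
    intro z hz
    rw [hdom] at hz
    exact ⟨fun i => hz (Fin.castSucc i), (hz (Fin.last n)).1.le, (hz (Fin.last n)).2.le⟩
  have hBC : B ⊆ {z : Fin (n + 1) → ℝ | ∀ i, z i ∈ Icc (a i) (b i)} := by
    rintro z ⟨hzτ, h1, h2⟩ i
    refine Fin.lastCases ?_ (fun j => ?_) i
    · exact ⟨h1, h2⟩
    · exact Ioo_subset_Icc_self (hzτ j)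
  -- the band integrand: `r.integrand` extended by zero off the open box
  set g : (Fin (n + 1) → ℝ) → ℝ := r.domain.indicator r.integrand with hg_def
  have hgS : IsSemialgebraicFunOn ℚ B g := by
    have h1 : IsSemialgebraicFunOn ℚ r.domain g :=
      r.isSemialgebraicFunOn_integrand.congr fun z hz => (indicator_of_mem hz _).symm
    have h2 : IsSemialgebraicFunOn ℚ (B \ r.domain) g :=
      (isSemialgebraicFunOn_ratCast (hB.diff r.isSemialgebraic_domain) 0).congr fun z hz => by
        simp [hg_def, indicator_of_notMem hz.2]
    have h := h1.union h2 (fun _ _ => rfl) (fun _ _ => rfl)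
    rwa [union_sdiff_cancel hOB] at h
  have hmeas : MeasurableSet r.domain := KZ.IntegralRep.measurableSet_domain_holds r
  have hgI : IntegrableOn g B := ((integrable_indicator_iff hmeas).mpr r.integrableOn).integrableOn
  let R : KZ.IntegralRep (n + 1) := ⟨B, g, hB, hgS, hgI⟩
  -- the base of the move: the zero representation on `τ`
  obtain ⟨Z, hZd, hZi⟩ := KZ.exists_zeroRep hτ
  have hZ : KZ.of Z ∈ KZ.relations := KZ.of_mem_relations_of_eqOn_zero Z (by simp [hZi, EqOn])
  -- membership of fibre points in the open box
  have hsnoc : ∀ x ∈ τ, ∀ t ∈ Ioo (a (Fin.last n)) (b (Fin.last n)),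
      (Fin.snoc x t : Fin (n + 1) → ℝ) ∈ r.domain := fun x hx t ht => by
    rw [hdom]
    exact snoc_mem_openBox_iff.2 ⟨hx, ht⟩
  -- ONE Newton–Leibniz move: `[R] − [Z]`
  have hNL : KZ.of R - KZ.of Z ∈ KZ.relations := by
    refine KZ.newtonLeibnizRel_subset_relations ⟨n, R, Z, fun _ => a (Fin.last n),
      fun _ => b (Fin.last n), H, hH.mono hBC hB, by rw [hZd]; exact haS, by rw [hZd]; exact hbS,
      fun _ _ => (hab (Fin.last n)).le, by rw [hZd]; rfl, fun x hx => ?_, fun x hx t ht => ?_,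
      fun x hx => ?_, rfl⟩
    · rw [hZd] at hx
      exact (hfib x hx).1
    · rw [hZd] at hx
      have h := (hfib x hx).2.2.2 t ht
      show HasDerivAt (fun s : ℝ => H (Fin.snoc x s)) (g (Fin.snoc x t)) t
      rw [hg_def, indicator_of_mem (hsnoc x hx t ht)]
      exact h
    · rw [hZd] at hx
      rw [hZi, (hfib x hx).2.1, (hfib x hx).2.2.1]
      simp
  have hR : KZ.of R ∈ KZ.relations := by
    simpa using KZ.relations.add_mem hNL hZ
  -- the two faces are null
  have hnull : volume (R.domain \ r.domain) = 0 := by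
    have hcov : R.domain \ r.domain ⊆ {z : Fin (n + 1) → ℝ | z (Fin.last n) = a (Fin.last n)} ∪
        {z : Fin (n + 1) → ℝ | z (Fin.last n) = b (Fin.last n)} := by
      rintro z ⟨⟨hzτ, h1, h2⟩, hz⟩
      rw [hdom] at hz
      simp only [mem_setOf_eq, not_forall] at hz
      obtain ⟨i, hi⟩ := hz
      revert hi
      refine Fin.lastCases (fun hi => ?_) (fun j hi => ?_) i
      · rcases h1.eq_or_lt with h | h
        · exact Or.inl h.symm
        · refine Or.inr (le_antisymm h2 (not_lt.mp fun h' => hi ⟨h, h'⟩))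
      · exact absurd (hzτ j) hi
    exact measure_mono_null hcov
      (measure_union_null (KZ.volume_setOf_last_eq_zero _) (KZ.volume_setOf_last_eq_zero _))
  -- `[R] − [R|box]` and `[R|box] − [r]` are relations
  have h2 : KZ.of R - KZ.of (R.restrict r.domain r.isSemialgebraic_domain hOB) ∈ KZ.relations :=
    R.of_sub_of_restrict_mem_relations r.isSemialgebraic_domain hOB hnull
  have h3 : KZ.of (R.restrict r.domain r.isSemialgebraic_domain hOB) - KZ.of r ∈ KZ.relations :=
    KZ.of_sub_of_mem_relations_of_eqOn rfl fun z hz => indicator_of_mem hz _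
  have heq : KZ.of r = KZ.of R - (KZ.of R - KZ.of (R.restrict r.domain r.isSemialgebraic_domain hOB)) -
      (KZ.of (R.restrict r.domain r.isSemialgebraic_domain hOB) - KZ.of r) := by
    abel
  rw [heq]
  exact KZ.relations.sub_mem (KZ.relations.sub_mem hR h2) h3

end Summit.KontsevichZagierPeriods.GaussManinCertificates
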